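import Mathlib.Tactic

/-!
# LINE 17 v7.2 · support for SWα `ShedSeedPrimeAtTwo` — the NEAR-CORE SQUEEZE (pure algebra)

bsd-idea-1 g14 (pen), 2026-08-29.  Sorry-free.  Toward crux U1
`KolyvaginRankRigidityAtTwo.KolyvaginBoundedDefectAtTwo` (stmt-BirchSwinnertonDyer-28083), stub SWα of
`line17/kolyvagin_swap_v72r.lean`.  Nothing here proves SWα, U1 or BSD.

Setting (abstracted): `A` = the modified Selmer group `H_{F(e″)}(K, E[2^M])` at a NEAR-CORE vertex `e″`
(tree: `RegularWalk.nearCoreExistenceAtTwo_holds`): every element is killed by `2^M` (`hA`) and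
`2^κ • A ⊆ ℤ • x'` for one generator `x'` (`hnc`).  `τ` = complex conjugation acting on `A`
(`F(e″)` is `Gal(K/ℚ)`-stable since `e″` is a product of rational primes).  `y` = `2^(v+b) • c_M(s·e″)`,
the walking Kolyvagin class pushed into `A` under the assumption «every seed prime `q ∣ s` carries singular
order `≤ 2^v`» (then `loc_q y = 0` by GK2 Q2 conj. 1, and the Kummer conditions elsewhere hold up to `2^b`).

* `sign_squeeze` : if `τ y = ε y` and the generator has the OPPOSITE sign up to `2^κ`
  (`2^κ • τ x' = (2^κ u₀) • x'` with `4 ∣ u₀ + ε`), then `2^(2κ+1) • y = 0` — the class was small.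
* `sign_squeeze'`: the same in the `t₀`-currency the prover meets (`2^κ • τ x' = t₀ • x'`, «opposite» =
  `2^(κ+2) ∣ t₀ + ε 2^κ`); `generator_coeff` / `generator_sign_dichotomy` (L3): `t₀ = 2^κ u₀` with `u₀` odd, so
  the generator HAS a sign mod 4 and every walking class is in case T1 (opposite) or T3′ (equal).
* `opposite_signs_pair_small` (L2): an invariant bi-additive pairing sends (sign-`u` class, sign-`−u` eigenvector)
  into the `2^(κ+1)`-torsion — the isotropy fact behind both v7.1's dead same-sign partner and T3′'s Lagrangian
  complement `Φ^⊥ ⊇ 2^(κ+1) H¹_s^{−u₀}` (card §v7.2 addendum 3).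
* `loc_squeeze`  : if a homomorphism `f` (think `loc_q` at a seed prime `q`) kills `y` while `f x'` has order
  `≥ 2^(M-j)`, then `2^(κ+j) • y = 0` — the class was small (T2; subsumed by T3′ but kept).

Either trigger contradicts the room `2^(v+κ') • c ≠ 0` of SWα's hypothesis for `κ'` large, so some seed
prime carries singular order `> 2^v`, which the DOWN reading (Q2 24880 by name + EV) turns into the shed.
PARITY NOTE (card §v7.2-addendum): an UP step flips the class sign `ε ↦ -ε`; in Kolyvagin's rigid world
(`V^f_{n,k} = ℓ^{m_f}·SD^{(f+1)}_M`, Kolyvagin 1991 Math. Ann. 291 p. 8) the generator sign flips too, so the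
sign trigger is governed by the parity of the number `|s|` of remaining seed primes, and EVEN `|s|` must use
`loc_squeeze`; «s invisible to the core» (all `loc_q x'(e″)` small for all reachable `e″`) is risk (a‴).
-/

-- the Cruxes namespace of this sub repeats the summit name by design (D-0017 nested layout)
set_option linter.dupNamespace false

namespace Summit.BirchSwinnertonDyer.BirchSwinnertonDyer.Cruxes.KolyvaginBoundedDefectAtTwo.KolyvaginSwap.NearCoreSqueeze

variable {A : Type*} [AddCommGroup A]

/-- An odd integer acts injectively on a `2^M`-torsion abelian group: `o • w = 0`, `o` odd, `2^M • w = 0`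
force `w = 0`.  Elementary proof: `w = (1 - o) • w` with `1 - o` even, iterated `M` times. -/
theorem eq_zero_of_odd_smul_eq_zero (M : ℕ) (w : A) (hM : ((2 : ℤ) ^ M) • w = 0)
    (o : ℤ) (ho : Odd o) (how : o • w = 0) : w = 0 := by
  obtain ⟨j, hj⟩ := ho
  -- `w = (1 - o) • w = (-(2 j)) • w`
  have step : w = ((2 : ℤ) * (-j)) • w := by
    have h1 : w = (1 - o) • w := by rw [sub_smul, one_smul, how, sub_zero]
    have h2 : (1 : ℤ) - o = 2 * (-j) := by rw [hj]; ring
    rw [h2] at h1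
    exact h1
  have key : ∀ n : ℕ, w = (((2 : ℤ) * (-j)) ^ n) • w := by
    intro n
    induction n with
    | zero => simp
    | succ n ih =>
        calc w = ((2 : ℤ) * (-j)) • w := step
          _ = ((2 : ℤ) * (-j)) • ((((2 : ℤ) * (-j)) ^ n) • w) := by rw [← ih]
          _ = (((2 : ℤ) * (-j)) ^ (n + 1)) • w := by rw [smul_smul, pow_succ, mul_comm]
  have hMw := key M
  rw [mul_pow, mul_comm, mul_smul, hM, smul_zero] at hMw
  exact hMw

/-- **Sign squeeze.**  In a `2^M`-torsion group that is near-cyclic (`2^κ • z ∈ ℤ • x'` for all `z`),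
with an additive involution-like map `τ` whose action on the generator is `2^κ • τ x' = (2^κ u₀) • x'`,
a `τ`-eigenvector `y` of sign `ε` OPPOSITE to `u₀` (`4 ∣ u₀ + ε`, `ε = ±1`) satisfies `2^(2κ+1) • y = 0`. -/
theorem sign_squeeze (M κ : ℕ) (hA : ∀ z : A, ((2 : ℤ) ^ M) • z = 0)
    (x' : A) (hnc : ∀ z : A, ∃ t : ℤ, ((2 : ℤ) ^ κ) • z = t • x')
    (τ : A →+ A) (u₀ : ℤ) (hx : ((2 : ℤ) ^ κ) • τ x' = ((2 : ℤ) ^ κ * u₀) • x')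
    (y : A) (ε : ℤ) (hε : ε = 1 ∨ ε = -1) (hy : τ y = ε • y) (hmis : (4 : ℤ) ∣ u₀ + ε) :
    ((2 : ℤ) ^ (2 * κ + 1)) • y = 0 := by
  obtain ⟨t, ht⟩ := hnc y
  obtain ⟨m, hm⟩ := hmis
  -- apply `2^κ • τ` to `2^κ • y = t • x'` in two ways
  have lhs : ((2 : ℤ) ^ κ) • τ (((2 : ℤ) ^ κ) • y) = ((2 : ℤ) ^ κ * ε * t) • x' := by
    rw [map_zsmul, hy, smul_comm ((2 : ℤ) ^ κ) ε y, ht, smul_smul, smul_smul]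
  have rhs : ((2 : ℤ) ^ κ) • τ (((2 : ℤ) ^ κ) • y) = ((2 : ℤ) ^ κ * u₀ * t) • x' := by
    rw [ht, map_zsmul, smul_smul, mul_comm ((2 : ℤ) ^ κ) t, ← smul_smul, hx, smul_smul]
    congr 1
    ring
  have diff : ((2 : ℤ) ^ κ * t * (u₀ - ε)) • x' = 0 := by
    have := rhs.symm.trans lhs
    -- `(2^κ u₀ t) • x' = (2^κ ε t) • x'`
    have h0 : ((2 : ℤ) ^ κ * u₀ * t - (2 : ℤ) ^ κ * ε * t) • x' = 0 := by
      rw [sub_smul, this, sub_self]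
    have h1 : (2 : ℤ) ^ κ * u₀ * t - (2 : ℤ) ^ κ * ε * t = (2 : ℤ) ^ κ * t * (u₀ - ε) := by ring
    rw [h1] at h0
    exact h0
  -- `u₀ - ε = 2 (2m - ε)` with `2m - ε` odd
  have hodd : Odd (2 * m - ε) := by
    rcases hε with rfl | rfl
    · exact ⟨m - 1, by ring⟩
    · exact ⟨m, by ring⟩
  have hu : u₀ - ε = 2 * (2 * m - ε) := by linarith
  -- `w := 2^(κ+1) t • x'` is killed by the odd number `2m - ε`
  set w : A := ((2 : ℤ) ^ (κ + 1) * t) • x' with hw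
  have how : (2 * m - ε) • w = 0 := by
    rw [hw, smul_smul]
    have h2 : (2 * m - ε) * ((2 : ℤ) ^ (κ + 1) * t) = (2 : ℤ) ^ κ * t * (u₀ - ε) := by
      rw [hu]; ring
    rw [h2]
    exact diff
  have hMw : ((2 : ℤ) ^ M) • w = 0 := by
    rw [hw, smul_smul, mul_comm, ← smul_smul, hA, smul_zero]
  have w0 : w = 0 := eq_zero_of_odd_smul_eq_zero M w hMw (2 * m - ε) hodd how
  -- conclude: `2^(2κ+1) • y = 2^(κ+1) • (2^κ • y) = 2^(κ+1) • (t • x') = w = 0`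
  calc ((2 : ℤ) ^ (2 * κ + 1)) • y = ((2 : ℤ) ^ (κ + 1)) • (((2 : ℤ) ^ κ) • y) := by
          rw [smul_smul, ← pow_add]; congr 2; ring
    _ = ((2 : ℤ) ^ (κ + 1)) • (t • x') := by rw [ht]
    _ = w := by rw [hw, smul_smul]
    _ = 0 := w0

/-- **Sign squeeze, `t₀`-form** (the shape the prover meets: near-coreness only gives
`2^κ • τ x' = t₀ • x'` for SOME integer `t₀`; «opposite signs» reads `2^(κ+2) ∣ t₀ + ε·2^κ`). -/
theorem sign_squeeze' (M κ : ℕ) (hA : ∀ z : A, ((2 : ℤ) ^ M) • z = 0)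
    (x' : A) (hnc : ∀ z : A, ∃ t : ℤ, ((2 : ℤ) ^ κ) • z = t • x')
    (τ : A →+ A) (t₀ : ℤ) (hx : ((2 : ℤ) ^ κ) • τ x' = t₀ • x')
    (y : A) (ε : ℤ) (hε : ε = 1 ∨ ε = -1) (hy : τ y = ε • y)
    (hmis : (2 : ℤ) ^ (κ + 2) ∣ t₀ + ε * 2 ^ κ) :
    ((2 : ℤ) ^ (2 * κ + 1)) • y = 0 := by
  obtain ⟨t, ht⟩ := hnc y
  obtain ⟨m, hm⟩ := hmis
  have lhs : ((2 : ℤ) ^ κ) • τ (((2 : ℤ) ^ κ) • y) = ((2 : ℤ) ^ κ * ε * t) • x' := by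
    rw [map_zsmul, hy, smul_comm ((2 : ℤ) ^ κ) ε y, ht, smul_smul, smul_smul]
  have rhs : ((2 : ℤ) ^ κ) • τ (((2 : ℤ) ^ κ) • y) = (t * t₀) • x' := by
    rw [ht, map_zsmul, smul_smul, mul_comm ((2 : ℤ) ^ κ) t, ← smul_smul, hx, smul_smul]
  have diff : (t * (t₀ - ε * (2 : ℤ) ^ κ)) • x' = 0 := by
    have h0 : (t * t₀ - (2 : ℤ) ^ κ * ε * t) • x' = 0 := by
      rw [sub_smul, ← rhs, lhs, sub_self]
    have h1 : t * t₀ - (2 : ℤ) ^ κ * ε * t = t * (t₀ - ε * (2 : ℤ) ^ κ) := by ring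
    rw [h1] at h0
    exact h0
  have hodd : Odd (2 * m - ε) := by
    rcases hε with rfl | rfl
    · exact ⟨m - 1, by ring⟩
    · exact ⟨m, by ring⟩
  have hu : t₀ - ε * (2 : ℤ) ^ κ = (2 : ℤ) ^ (κ + 1) * (2 * m - ε) := by
    have : t₀ = (2 : ℤ) ^ (κ + 2) * m - ε * 2 ^ κ := by linarith
    rw [this]; ring
  set w : A := ((2 : ℤ) ^ (κ + 1) * t) • x' with hw
  have how : (2 * m - ε) • w = 0 := by
    rw [hw, smul_smul]
    have h2 : (2 * m - ε) * ((2 : ℤ) ^ (κ + 1) * t) = t * (t₀ - ε * (2 : ℤ) ^ κ) := by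
      rw [hu]; ring
    rw [h2]
    exact diff
  have hMw : ((2 : ℤ) ^ M) • w = 0 := by
    rw [hw, smul_smul, mul_comm, ← smul_smul, hA, smul_zero]
  have w0 : w = 0 := eq_zero_of_odd_smul_eq_zero M w hMw (2 * m - ε) hodd how
  calc ((2 : ℤ) ^ (2 * κ + 1)) • y = ((2 : ℤ) ^ (κ + 1)) • (((2 : ℤ) ^ κ) • y) := by
          rw [smul_smul, ← pow_add]; congr 2; ring
    _ = ((2 : ℤ) ^ (κ + 1)) • (t • x') := by rw [ht]
    _ = w := by rw [hw, smul_smul]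
    _ = 0 := w0

/-- **Generator coefficient** (L3): for a generator `x'` of exact order `2^M` of a group on which `τ` is
an involution, `2^κ • τ x' = t₀ • x'` forces `t₀ = 2^κ u₀` with `u₀` ODD (as soon as `2κ + 1 ≤ M`).
Hence the generator HAS a sign: `u₀ ≡ 1` or `u₀ ≡ -1 (mod 4)` (`generator_sign_dichotomy`). -/
theorem generator_coeff (M κ : ℕ) (hM : 2 * κ + 1 ≤ M) (x' : A) (hx' : addOrderOf x' = 2 ^ M)
    (τ : A →+ A) (hτ : ∀ z, τ (τ z) = z) (t₀ : ℤ) (hx : ((2 : ℤ) ^ κ) • τ x' = t₀ • x') :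
    ∃ u₀ : ℤ, Odd u₀ ∧ t₀ = 2 ^ κ * u₀ := by
  -- `2^κ • τ (2^κ • τ x') = 2^(2κ) • x'` and `= t₀² • x'`
  have h1 : (t₀ ^ 2 - (2 : ℤ) ^ (2 * κ)) • x' = 0 := by
    have e1 : ((2 : ℤ) ^ κ) • τ (((2 : ℤ) ^ κ) • τ x') = ((2 : ℤ) ^ (2 * κ)) • x' := by
      rw [map_zsmul, hτ, smul_smul, ← pow_add]; congr 2; ring
    have e2 : ((2 : ℤ) ^ κ) • τ (((2 : ℤ) ^ κ) • τ x') = (t₀ ^ 2) • x' := by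
      rw [hx, map_zsmul, smul_comm ((2 : ℤ) ^ κ) t₀ (τ x'), hx, smul_smul, sq]
    rw [sub_smul, ← e2, e1, sub_self]
  have h2 : ((2 : ℤ) ^ M) ∣ t₀ ^ 2 - (2 : ℤ) ^ (2 * κ) := by
    have := (addOrderOf_dvd_iff_zsmul_eq_zero).mpr h1
    rw [hx'] at this
    exact_mod_cast this
  have h3 : ((2 : ℤ) ^ (2 * κ)) ∣ t₀ ^ 2 := by
    have hpow : ((2 : ℤ) ^ (2 * κ)) ∣ (2 : ℤ) ^ M := pow_dvd_pow 2 (by omega)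
    have := (hpow.trans h2).add (dvd_refl ((2 : ℤ) ^ (2 * κ)))
    simpa using this
  have h4 : ((2 : ℤ) ^ κ) ∣ t₀ := by
    rcases Nat.eq_zero_or_pos κ with hκ | hκ
    · subst hκ; simp
    · have : ((2 : ℤ) ^ κ) ^ 2 ∣ t₀ ^ 2 := by rw [← pow_mul, mul_comm]; exact h3
      exact (Int.pow_dvd_pow_iff two_ne_zero).mp this
  obtain ⟨u₀, hu⟩ := h4
  refine ⟨u₀, ?_, hu⟩
  -- oddness: `2^M ∣ 2^(2κ) (u₀² - 1)` with `M > 2κ`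
  have h5 : (2 : ℤ) ∣ u₀ ^ 2 - 1 := by
    have e3 : t₀ ^ 2 - (2 : ℤ) ^ (2 * κ) = (2 : ℤ) ^ (2 * κ) * (u₀ ^ 2 - 1) := by
      rw [hu]; ring
    have hpow : ((2 : ℤ) ^ (2 * κ) * 2) ∣ (2 : ℤ) ^ M := by
      rw [← pow_succ]; exact pow_dvd_pow 2 (by omega)
    have := hpow.trans h2
    rw [e3] at this
    exact (mul_dvd_mul_iff_left (pow_ne_zero _ two_ne_zero)).mp this
  rcases Int.even_or_odd u₀ with ⟨k, hk⟩ | hodd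
  · exfalso
    have : Odd (u₀ ^ 2 - 1) := ⟨2 * k ^ 2 - 1, by rw [hk]; ring⟩
    exact (Int.not_even_iff_odd.mpr this) (even_iff_two_dvd.mpr h5)
  · exact hodd

/-- The generator's sign is well defined: `u₀ ≡ 1` or `u₀ ≡ -1 (mod 4)`, i.e. in the `t₀`-currency
`2^(κ+2) ∣ t₀ - 2^κ` or `2^(κ+2) ∣ t₀ + 2^κ` — so every walking class meets T1 (opposite) or T3′ (equal). -/
theorem generator_sign_dichotomy (M κ : ℕ) (hM : 2 * κ + 1 ≤ M) (x' : A) (hx' : addOrderOf x' = 2 ^ M)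
    (τ : A →+ A) (hτ : ∀ z, τ (τ z) = z) (t₀ : ℤ) (hx : ((2 : ℤ) ^ κ) • τ x' = t₀ • x') :
    (2 : ℤ) ^ (κ + 2) ∣ t₀ - 2 ^ κ ∨ (2 : ℤ) ^ (κ + 2) ∣ t₀ + 2 ^ κ := by
  obtain ⟨u₀, hodd, rfl⟩ := generator_coeff M κ hM x' hx' τ hτ t₀ hx
  obtain ⟨k, hk⟩ := hodd
  have h4 : (4 : ℤ) ∣ u₀ - 1 ∨ (4 : ℤ) ∣ u₀ + 1 := by omega
  rcases h4 with ⟨m, hm⟩ | ⟨m, hm⟩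
  · left
    refine ⟨m, ?_⟩
    have : (2 : ℤ) ^ κ * u₀ - 2 ^ κ = 2 ^ κ * (u₀ - 1) := by ring
    rw [this, hm]; ring
  · right
    refine ⟨m, ?_⟩
    have : (2 : ℤ) ^ κ * u₀ + 2 ^ κ = 2 ^ κ * (u₀ + 1) := by ring
    rw [this, hm]; ring

/-- **Opposite signs pair small** (L2): for a bi-additive pairing `B` invariant under a pair of operators
(`B (hF f) (hS s) = B f s`; think: the local Tate pairing `H¹_f(K_q) × H¹_s(K_q) → ℤ/2^M` and the
action of `Frob_q`, which restricts to `τ`), a class `f` with `2^κ • hF f = t₀ • f` and `t₀ ≡ u·2^κ (mod 2^(κ+2))`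
(sign `u` up to `2^κ`) pairs with an eigenvector `s` of the OPPOSITE sign `-u` into the `2^(κ+1)`-torsion. -/
theorem opposite_signs_pair_small {F S Q : Type*} [AddCommGroup F] [AddCommGroup S] [AddCommGroup Q]
    (M : ℕ) (B : F →+ S →+ Q) (hF : F →+ F) (hS : S →+ S)
    (hinv : ∀ (f : F) (s : S), B (hF f) (hS s) = B f s)
    (κ : ℕ) (t₀ u : ℤ) (hu : u = 1 ∨ u = -1)
    (f : F) (hf : ((2 : ℤ) ^ κ) • hF f = t₀ • f) (s : S) (hs : hS s = (-u) • s)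
    (heq : (2 : ℤ) ^ (κ + 2) ∣ t₀ - u * 2 ^ κ) (hQ : ((2 : ℤ) ^ M) • B f s = 0) :
    ((2 : ℤ) ^ (κ + 1)) • B f s = 0 := by
  obtain ⟨m, hm⟩ := heq
  -- `2^κ • B f s = B (2^κ • hF f) (hS s) = B (t₀ • f) ((-u) • s) = (t₀ * (-u)) • B f s`
  have e1 : ((2 : ℤ) ^ κ) • B f s = (t₀ * (-u)) • B f s := by
    have step1 : ((2 : ℤ) ^ κ) • B f s = B (((2 : ℤ) ^ κ) • hF f) (hS s) := by
      rw [map_zsmul, AddMonoidHom.zsmul_apply, hinv]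
    rw [step1, hf, hs, map_zsmul B t₀ f, AddMonoidHom.zsmul_apply, map_zsmul, smul_smul]
  -- `(2^κ + u t₀) • B f s = 0` and `2^κ + u t₀ = 2^(κ+1) (1 + 2 u m)` with `1 + 2um` odd
  have e2 : ((2 : ℤ) ^ (κ + 1) * (1 + 2 * u * m)) • B f s = 0 := by
    have h0 : ((2 : ℤ) ^ κ - t₀ * (-u)) • B f s = 0 := by rw [sub_smul, e1, sub_self]
    have ht : t₀ = (2 : ℤ) ^ (κ + 2) * m + u * 2 ^ κ := by linarith
    have h1 : (2 : ℤ) ^ κ - t₀ * (-u) = (2 : ℤ) ^ (κ + 1) * (1 + 2 * u * m) := by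
      rw [ht]; rcases hu with rfl | rfl <;> ring
    rw [h1] at h0
    exact h0
  have hodd : Odd (1 + 2 * u * m) := ⟨u * m, by ring⟩
  set w : Q := ((2 : ℤ) ^ (κ + 1)) • B f s with hw
  have how : (1 + 2 * u * m) • w = 0 := by
    rw [hw, smul_smul, mul_comm]; exact e2
  have hMw : ((2 : ℤ) ^ M) • w = 0 := by
    rw [hw, smul_comm, hQ, smul_zero]
  exact eq_zero_of_odd_smul_eq_zero M w hMw (1 + 2 * u * m) hodd how

/-- **Loc squeeze.**  Same near-cyclic setting; if a homomorphism `f` (a localisation `loc_q` at a seed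
prime) kills `y` while `f x'` has order at least `2^(M-j)` (every `t` with `t • f x' = 0` is divisible by
`2^(M-j)`), then `2^(κ+j) • y = 0`. -/
theorem loc_squeeze {B : Type*} [AddCommGroup B] (M κ j : ℕ) (hj : j ≤ M)
    (hA : ∀ z : A, ((2 : ℤ) ^ M) • z = 0)
    (x' : A) (hnc : ∀ z : A, ∃ t : ℤ, ((2 : ℤ) ^ κ) • z = t • x')
    (f : A →+ B) (hfx : ∀ t : ℤ, t • f x' = 0 → ((2 : ℤ) ^ (M - j)) ∣ t)
    (y : A) (hfy : f y = 0) : ((2 : ℤ) ^ (κ + j)) • y = 0 := by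
  obtain ⟨t, ht⟩ := hnc y
  have h0 : t • f x' = 0 := by
    rw [← map_zsmul, ← ht, map_zsmul, hfy, smul_zero]
  obtain ⟨t', rfl⟩ := hfx t h0
  calc ((2 : ℤ) ^ (κ + j)) • y = ((2 : ℤ) ^ j) • (((2 : ℤ) ^ κ) • y) := by
          rw [smul_smul, ← pow_add, add_comm κ j]
    _ = ((2 : ℤ) ^ j) • (((2 : ℤ) ^ (M - j) * t') • x') := by rw [ht]
    _ = t' • (((2 : ℤ) ^ M) • x') := by
          rw [smul_smul, smul_smul]; congr 1
          rw [← mul_assoc, ← pow_add, Nat.add_sub_cancel' hj, mul_comm]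
    _ = 0 := by rw [hA, smul_zero]

/-- The dichotomy the SWα prover uses (contrapositive packaging of the two squeezes): a ROOMY class
(`2^(2κ+1) • y ≠ 0` and `2^(κ+j) • y ≠ 0`) sitting in a near-core group can neither have the sign opposite
to the generator nor die under a localisation at which the generator is big. -/
theorem roomy_class_escapes {B : Type*} [AddCommGroup B] (M κ j : ℕ) (hj : j ≤ M)
    (hA : ∀ z : A, ((2 : ℤ) ^ M) • z = 0)
    (x' : A) (hnc : ∀ z : A, ∃ t : ℤ, ((2 : ℤ) ^ κ) • z = t • x')
    (τ : A →+ A) (u₀ : ℤ) (hx : ((2 : ℤ) ^ κ) • τ x' = ((2 : ℤ) ^ κ * u₀) • x')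
    (f : A →+ B) (hfx : ∀ t : ℤ, t • f x' = 0 → ((2 : ℤ) ^ (M - j)) ∣ t)
    (y : A) (ε : ℤ) (hε : ε = 1 ∨ ε = -1) (hy : τ y = ε • y)
    (hroom₁ : ((2 : ℤ) ^ (2 * κ + 1)) • y ≠ 0) (hroom₂ : ((2 : ℤ) ^ (κ + j)) • y ≠ 0) :
    ¬ (4 : ℤ) ∣ u₀ + ε ∧ f y ≠ 0 :=
  ⟨fun hmis => hroom₁ (sign_squeeze M κ hA x' hnc τ u₀ hx y ε hε hy hmis),
   fun hfy => hroom₂ (loc_squeeze M κ j hj hA x' hnc f hfx y hfy)⟩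


/-! ## v3 (g14, ~10:45Z) — the EIGEN-DICHOTOMY algebra of the FRAMELESS blueprint (card §v7.3, file
`kolyvagin_swap_v73r.lean`): no near-core hypothesis anywhere below. -/

/-- **Symmetrisation gives an exact eigenvector.**  For an involution `h` and a sign `u = ±1`, the element
`s - u • h s` is an EXACT `(-u)`-eigenvector of `h`. -/
theorem symmetrise_sign (h : A →+ A) (hh : ∀ z : A, h (h z) = z) (u : ℤ) (hu : u = 1 ∨ u = -1) (s : A) :
    h (s - u • h s) = (-u) • (s - u • h s) := by
  rw [map_sub, map_zsmul, hh, smul_sub, smul_smul]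
  rcases hu with rfl | rfl <;> simp <;> abel

/-- **Symmetrisation keeps the `u`-part exact too.** `s + u • h s` is an exact `u`-eigenvector. -/
theorem symmetrise_sign' (h : A →+ A) (hh : ∀ z : A, h (h z) = z) (u : ℤ) (hu : u = 1 ∨ u = -1) (s : A) :
    h (s + u • h s) = u • (s + u • h s) := by
  rw [map_add, map_zsmul, hh, smul_add, smul_smul]
  rcases hu with rfl | rfl <;> simp <;> abel

/-- **Opposite exact signs pair to one bit.**  For a pairing `B` invariant under a pair of maps
(`B (hF f) (hS s) = B f s` — the local Tate pairing and complex conjugation, `localTatePairingZMod_conjActPlace`),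
an exact `u`-eigenvector of `hF` and an exact `(-u)`-eigenvector of `hS` pair to a `2`-torsion value. -/
theorem two_smul_pair_eq_zero_of_opposite {F S Q : Type*} [AddCommGroup F] [AddCommGroup S] [AddCommGroup Q]
    (B : F →+ S →+ Q) (hF : F →+ F) (hS : S →+ S)
    (hinv : ∀ (f : F) (s : S), B (hF f) (hS s) = B f s) (u : ℤ) (hu : u = 1 ∨ u = -1)
    (f : F) (hf : hF f = u • f) (t : S) (ht : hS t = (-u) • t) : (2 : ℤ) • B f t = 0 := by
  have e1 : B f t = (u * -u) • B f t := by
    conv_lhs => rw [← hinv f t, hf, ht]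
    rw [map_zsmul B u f, AddMonoidHom.zsmul_apply, map_zsmul, smul_smul]
  have hu2 : u * -u = -1 := by rcases hu with rfl | rfl <;> norm_num
  rw [hu2, neg_one_zsmul] at e1
  -- `B f t = - B f t`
  have : (2 : ℤ) • B f t = B f t + B f t := two_zsmul _
  rw [this]
  nth_rewrite 2 [e1]
  exact add_neg_cancel _

/-- **EIGEN-ANNIHILATOR (case (L) of the dichotomy).**  Let `Φ ∋ φ` be stable under the involution `hF`
(`hF φ ∈ Φ` is only used through the hypothesis on `φ` and `hF φ` below) and suppose the `(-u)`-part of `Φ`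
has exponent `≤ a`: `2^a • (φ - u • hF φ) = 0`.  Then for EVERY `s`, the symmetrised element
`2^(a+2) • (s - u • hS s)` (an exact `(-u)`-eigenvector, `symmetrise_sign`) is annihilated by `φ` under `B`.
In the blueprint: `Φ = loc_q H_{𝓕(e)} ⊆ H_f(q)`, `S = H_tr(q)`; so `ann_{H_tr}(Φ) ⊇ 2^(a+2) • (1 - u•τ) H_tr(q)`,
and the graph lemma `RegularRefill.exists_mem_sub_mem_of_lagrangian` turns any such element into the singular
part of a class of the relaxed Selmer group `H_{𝓕(e)^q}` — the partner, with NO near-core hypothesis. -/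
theorem eigen_annihilator {F S Q : Type*} [AddCommGroup F] [AddCommGroup S] [AddCommGroup Q]
    (B : F →+ S →+ Q) (hF : F →+ F) (hS : S →+ S) (hFF : ∀ z : F, hF (hF z) = z) (hSS : ∀ z : S, hS (hS z) = z)
    (hinv : ∀ (f : F) (s : S), B (hF f) (hS s) = B f s) (u : ℤ) (hu : u = 1 ∨ u = -1) (a : ℕ)
    (φ : F) (hφ : ((2 : ℤ) ^ a) • (φ - u • hF φ) = 0) (s : S) :
    B φ (((2 : ℤ) ^ (a + 2)) • (s - u • hS s)) = 0 := by
  set t : S := s - u • hS s with ht_def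
  have ht : hS t = (-u) • t := symmetrise_sign hS hSS u hu s
  -- split `2 • φ = (φ + u hF φ) + (φ - u hF φ)`
  set ap : F := φ + u • hF φ with hap_def
  set am : F := φ - u • hF φ with ham_def
  have hsplit : (2 : ℤ) • φ = ap + am := by
    rw [hap_def, ham_def, two_zsmul]; abel
  have hap : hF ap = u • ap := symmetrise_sign' hF hFF u hu φ
  -- the `u`-part pairs with `t` to a 2-torsion value
  have h1 : (2 : ℤ) • B ap t = 0 := two_smul_pair_eq_zero_of_opposite B hF hS hinv u hu ap hap t ht
  -- the `(-u)`-part is killed by `2^a`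
  have h2 : ((2 : ℤ) ^ a) • B am t = 0 := by
    rw [← AddMonoidHom.zsmul_apply, ← map_zsmul, hφ, map_zero, AddMonoidHom.zero_apply]
  have h1' : ((2 : ℤ) ^ (a + 1)) • B ap t = 0 := by
    rw [pow_succ, mul_smul, h1, smul_zero]
  have h2' : ((2 : ℤ) ^ (a + 1)) • B am t = 0 := by
    rw [pow_succ, mul_comm, mul_smul, h2, smul_zero]
  -- assemble: `B φ (2^(a+2) • t) = 2^(a+1) • B (2 • φ) t = 2^(a+1) • (B ap t + B am t) = 0`
  calc B φ (((2 : ℤ) ^ (a + 2)) • t)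
      = ((2 : ℤ) ^ (a + 1)) • ((2 : ℤ) • B φ t) := by rw [map_zsmul, pow_succ, mul_smul]
    _ = ((2 : ℤ) ^ (a + 1)) • B ((2 : ℤ) • φ) t := by rw [map_zsmul B (2 : ℤ) φ, AddMonoidHom.zsmul_apply]
    _ = ((2 : ℤ) ^ (a + 1)) • B ap t + ((2 : ℤ) ^ (a + 1)) • B am t := by
          rw [hsplit, map_add, AddMonoidHom.add_apply, smul_add]
    _ = 0 := by rw [h1', h2', add_zero]

/-- **THE DICHOTOMY (logic only).**  Either some element of the `(-u)`-symmetrised image has order NOT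
dividing `2^a` (case (G): it is the partner), or all of them are killed by `2^a` (case (L): `eigen_annihilator`
applies to every `φ`). -/
theorem eigen_dichotomy (hF : A →+ A) (u : ℤ) (a : ℕ) (Φ : Set A) :
    (∃ φ ∈ Φ, ((2 : ℤ) ^ a) • (φ - u • hF φ) ≠ 0) ∨ (∀ φ ∈ Φ, ((2 : ℤ) ^ a) • (φ - u • hF φ) = 0) := by
  by_cases h : ∀ φ ∈ Φ, ((2 : ℤ) ^ a) • (φ - u • hF φ) = 0
  · exact Or.inr h
  · refine Or.inl ?_
    by_contra h'
    exact h fun φ hφ ↦ by_contra fun hne ↦ h' ⟨φ, hφ, hne⟩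

end Summit.BirchSwinnertonDyer.BirchSwinnertonDyer.Cruxes.KolyvaginBoundedDefectAtTwo.KolyvaginSwap.NearCoreSqueeze
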